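import Summits.ResolutionOfSingularities.ResolutionOfSingularities.Theses.EquisingularLift
import Mathlib.LinearAlgebra.Matrix.Adjugate
import Mathlib.RingTheory.Ideal.Quotient.Basic
import Mathlib.Data.ZMod.Basic

/-!
# `EquisingularLift` / `EquisingularLiftNat` — negative lemma: the Fano configuration does not lift

Support (negative) lemma for the cruxes `stmt-ResolutionOfSingularities-15660` (`…Theses.EquisingularLift.EquisingularLift`)
and `stmt-ResolutionOfSingularities-20038` (`…Theses.EquisingularLift.EquisingularLiftNat`), filed by triager 2
(res-L1-w45b-tri-2, gen 3; crux chain w45b, CHAIN v5 §3 deliverable (2) «Negative ¬ConfigurationLiftCanonical₃»).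
[OURS · L1 W4.5b] No definition is declared and no theorem asserts a Theses decl positively.

CONTENT. The load-bearing arithmetic behind the death of the «points-first» configuration-lift line
(`ConfigurationLift(3)`, kit j259083 / j260016; CRUX-PLAN v2 F-line; TRIAGE tri-2 §5–§7): the seven singular points of the
Fano surface `H_F ⊂ ℙ³_{𝔽̄₂}` sit on the seven lines of a Fano plane `ℙ²(𝔽₂)`, and a lift of the seven points to
`O`-points of `ℙ²_O` (any local domain `O` with residue characteristic whatever and `2 ≠ 0` in `O`) preserving the seven
collinearities over the generic fibre does not exist — the Fano plane is not representable in characteristic `≠ 2`.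
`fano_configuration_no_lift`: for a domain `O` with `(2 : O) ≠ 0`, a proper ideal `I`, and vectors `v x : Fin 3 → O`
indexed by `x : Fin 3 → ZMod 2` with `v x ≡ x (mod I)` coordinatewise, the seven conditions
`det (v a, v b, v (a + b)) = 0` (`a ≠ 0`, `b ≠ 0`, `a ≠ b`) are contradictory. Proof: normalise by the adjugate of the frame
`M = (v e₀ | v e₁ | v e₂)` (`det M ≡ 1 (mod I)`, so `det M ≠ 0`); the six lines through a frame vector force three zero
coordinates and three bilinear relations, and the seventh determinant then equals `2·(product of elements ≡ 1 mod I)`.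
`fano_configuration_lift_of_two_eq_zero`: conversely, if `(2 : O) = 0` the constant `0/1` lift satisfies all seven
conditions — the hypothesis `(2 : O) ≠ 0` is load-bearing (this is the equal-characteristic escape `O = k[[t]]`).
Kernel-only (propext, Classical.choice, Quot.sound). [folklore]
-/

noncomputable section

set_option linter.dupNamespace false

namespace Summit.ResolutionOfSingularities.ResolutionOfSingularities.Theorems.EquisingularLift.Negative

open Matrix

/-- **The Fano configuration has no lift to characteristic `≠ 2`.** Let `O` be a domain with `(2 : O) ≠ 0` and
`I ⊊ O` an ideal. There is no family of vectors `v x : Fin 3 → O`, `x : Fin 3 → ZMod 2`, with `v x i ≡ x i (mod I)`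
such that `v a, v b, v (a + b)` are linearly dependent (zero determinant) for all distinct non-zero `a b` — i.e. no lift
of the seven points of `ℙ²(𝔽₂)` to `O`-points of `ℙ²_O` keeps the seven Fano lines. [folklore] -/
theorem fano_configuration_no_lift {O : Type*} [CommRing O] [IsDomain O] (h2 : (2 : O) ≠ 0)
    (I : Ideal O) (hI : I ≠ ⊤) (v : (Fin 3 → ZMod 2) → Fin 3 → O)
    (hv : ∀ x i, v x i - ((x i).val : O) ∈ I)
    (hdet : ∀ a b : Fin 3 → ZMod 2, a ≠ 0 → b ≠ 0 → a ≠ b →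
      (Matrix.of ![v a, v b, v (a + b)]).det = 0) :
    False := by
  classical
  -- the seven lines, instantiated
  have L1 : (Matrix.of ![v ![1,0,0], v ![0,1,0], v ![1,1,0]]).det = 0 := by
    have h := hdet ![1,0,0] ![0,1,0] (by decide) (by decide) (by decide)
    have e : ((![1,0,0] : Fin 3 → ZMod 2) + ![0,1,0]) = ![1,1,0] := by decide
    rwa [e] at h
  have L2 : (Matrix.of ![v ![0,1,0], v ![0,0,1], v ![0,1,1]]).det = 0 := by
    have h := hdet ![0,1,0] ![0,0,1] (by decide) (by decide) (by decide)
    have e : ((![0,1,0] : Fin 3 → ZMod 2) + ![0,0,1]) = ![0,1,1] := by decide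
    rwa [e] at h
  have L3 : (Matrix.of ![v ![1,0,0], v ![0,0,1], v ![1,0,1]]).det = 0 := by
    have h := hdet ![1,0,0] ![0,0,1] (by decide) (by decide) (by decide)
    have e : ((![1,0,0] : Fin 3 → ZMod 2) + ![0,0,1]) = ![1,0,1] := by decide
    rwa [e] at h
  have L4 : (Matrix.of ![v ![1,0,0], v ![0,1,1], v ![1,1,1]]).det = 0 := by
    have h := hdet ![1,0,0] ![0,1,1] (by decide) (by decide) (by decide)
    have e : ((![1,0,0] : Fin 3 → ZMod 2) + ![0,1,1]) = ![1,1,1] := by decide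
    rwa [e] at h
  have L5 : (Matrix.of ![v ![0,1,0], v ![1,0,1], v ![1,1,1]]).det = 0 := by
    have h := hdet ![0,1,0] ![1,0,1] (by decide) (by decide) (by decide)
    have e : ((![0,1,0] : Fin 3 → ZMod 2) + ![1,0,1]) = ![1,1,1] := by decide
    rwa [e] at h
  have L6 : (Matrix.of ![v ![0,0,1], v ![1,1,0], v ![1,1,1]]).det = 0 := by
    have h := hdet ![0,0,1] ![1,1,0] (by decide) (by decide) (by decide)
    have e : ((![0,0,1] : Fin 3 → ZMod 2) + ![1,1,0]) = ![1,1,1] := by decide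
    rwa [e] at h
  have L7 : (Matrix.of ![v ![1,1,0], v ![0,1,1], v ![1,0,1]]).det = 0 := by
    have h := hdet ![1,1,0] ![0,1,1] (by decide) (by decide) (by decide)
    have e : ((![1,1,0] : Fin 3 → ZMod 2) + ![0,1,1]) = ![1,0,1] := by decide
    rwa [e] at h
  -- the frame matrix (columns `v e₀, v e₁, v e₂`), its adjugate, and the normalised vectors `w x`
  obtain ⟨M, hM⟩ : ∃ M : Matrix (Fin 3) (Fin 3) O,
      M = (Matrix.of ![v ![1,0,0], v ![0,1,0], v ![0,0,1]])ᵀ := ⟨_, rfl⟩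
  obtain ⟨w, hw⟩ : ∃ w : (Fin 3 → ZMod 2) → Fin 3 → O, ∀ x, w x = M.adjugate *ᵥ v x :=
    ⟨_, fun _ => rfl⟩
  have key : ∀ u : Fin 3 → O, M.adjugate *ᵥ (M *ᵥ u) = M.det • u := by
    intro u
    rw [Matrix.mulVec_mulVec, Matrix.adjugate_mul, Matrix.smul_mulVec, Matrix.one_mulVec]
  have hcol0 : M *ᵥ Pi.single 0 1 = v ![1,0,0] := by
    rw [Matrix.mulVec_single_one]; funext i; rw [Matrix.col_apply, hM]; simp
  have hcol1 : M *ᵥ Pi.single 1 1 = v ![0,1,0] := by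
    rw [Matrix.mulVec_single_one]; funext i; rw [Matrix.col_apply, hM]; simp
  have hcol2 : M *ᵥ Pi.single 2 1 = v ![0,0,1] := by
    rw [Matrix.mulVec_single_one]; funext i; rw [Matrix.col_apply, hM]; simp
  -- abbreviate `d = det M`
  obtain ⟨d, hd⟩ : ∃ d : O, M.det = d := ⟨_, rfl⟩
  have hw0 : w ![1,0,0] = ![d, 0, 0] := by
    rw [hw, ← hcol0, key, hd]; funext i; fin_cases i <;> simp
  have hw1 : w ![0,1,0] = ![0, d, 0] := by
    rw [hw, ← hcol1, key, hd]; funext i; fin_cases i <;> simp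
  have hw2 : w ![0,0,1] = ![0, 0, d] := by
    rw [hw, ← hcol2, key, hd]; funext i; fin_cases i <;> simp
  -- determinants transfer from `v` to `w`
  have transfer : ∀ x y z : Fin 3 → ZMod 2, (Matrix.of ![v x, v y, v z]).det = 0 →
      (Matrix.of ![w x, w y, w z]).det = 0 := by
    intro x y z h
    have hmat : Matrix.of ![w x, w y, w z] = Matrix.of ![v x, v y, v z] * M.adjugateᵀ := by
      ext i j
      fin_cases i <;>
        simp [hw, Matrix.mul_apply, Matrix.mulVec, dotProduct, Matrix.transpose_apply, Fin.sum_univ_three,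
          mul_comm]
    rw [hmat, Matrix.det_mul, h, zero_mul]
  -- coordinates of the four non-frame vectors
  obtain ⟨x, y, z, hP⟩ : ∃ x y z : O, w ![1,1,0] = ![x, y, z] :=
    ⟨_, _, _, by funext i; fin_cases i <;> rfl⟩
  obtain ⟨x', y', z', hP'⟩ : ∃ x' y' z' : O, w ![0,1,1] = ![x', y', z'] :=
    ⟨_, _, _, by funext i; fin_cases i <;> rfl⟩
  obtain ⟨x'', y'', z'', hP''⟩ : ∃ x'' y'' z'' : O, w ![1,0,1] = ![x'', y'', z''] :=
    ⟨_, _, _, by funext i; fin_cases i <;> rfl⟩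
  obtain ⟨a, b, c, hQ⟩ : ∃ a b c : O, w ![1,1,1] = ![a, b, c] :=
    ⟨_, _, _, by funext i; fin_cases i <;> rfl⟩
  -- the seven normalised determinants
  have W1 := transfer _ _ _ L1
  have W2 := transfer _ _ _ L2
  have W3 := transfer _ _ _ L3
  have W4 := transfer _ _ _ L4
  have W5 := transfer _ _ _ L5
  have W6 := transfer _ _ _ L6
  have W7 := transfer _ _ _ L7
  rw [hw0, hw1, hP] at W1
  rw [hw1, hw2, hP'] at W2
  rw [hw0, hw2, hP''] at W3
  rw [hw0, hP', hQ] at W4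
  rw [hw1, hP'', hQ] at W5
  rw [hw2, hP, hQ] at W6
  rw [hP, hP', hP''] at W7
  simp [Matrix.det_fin_three] at W1 W2 W3 W4 W5 W6 W7
  -- residues modulo `I`: everything `≡ 1` is non-zero
  set π := Ideal.Quotient.mk I with hπ
  have hvπ : ∀ s i, π (v s i) = ((s i).val : O ⧸ I) := by
    intro s i
    rw [← map_natCast π]
    exact (Ideal.Quotient.eq).mpr (hv s i)
  have hv1 : ((1 : ZMod 2)).val = 1 := rfl
  have hv0 : ((0 : ZMod 2)).val = 0 := rfl
  have hMπ : M.map π = 1 := by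
    ext i j
    fin_cases i <;> fin_cases j <;> simp [hM, hvπ, hv1, hv0]
  have hAπ : M.adjugate.map π = 1 := by
    have h := RingHom.map_adjugate π M
    rw [RingHom.mapMatrix_apply, RingHom.mapMatrix_apply, hMπ, Matrix.adjugate_one] at h
    exact h
  have hdπ : π d = 1 := by
    rw [← hd, RingHom.map_det, RingHom.mapMatrix_apply, hMπ, Matrix.det_one]
  have hwπ : ∀ s j, π (w s j) = ((s j).val : O ⧸ I) := by
    intro s j
    rw [hw, RingHom.map_mulVec, hAπ, Matrix.one_mulVec, Function.comp_apply, hvπ]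
  have ne_of_one : ∀ u : O, π u = 1 → u ≠ 0 := by
    rintro u hu rfl
    rw [map_zero] at hu
    exact hI (Ideal.Quotient.zero_eq_one_iff.mp hu)
  have hd0 : d ≠ 0 := ne_of_one d hdπ
  have ha : a ≠ 0 := ne_of_one a (by
    have h := hwπ ![1,1,1] 0; rw [hQ] at h; simpa [hv1] using h)
  have hb : b ≠ 0 := ne_of_one b (by
    have h := hwπ ![1,1,1] 1; rw [hQ] at h; simpa [hv1] using h)
  have hy : y ≠ 0 := ne_of_one y (by
    have h := hwπ ![1,1,0] 1; rw [hP] at h; simpa [hv1] using h)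
  have hz' : z' ≠ 0 := ne_of_one z' (by
    have h := hwπ ![0,1,1] 2; rw [hP'] at h; simpa [hv1] using h)
  have hz'' : z'' ≠ 0 := ne_of_one z'' (by
    have h := hwπ ![1,0,1] 2; rw [hP''] at h; simpa [hv1] using h)
  -- the frame lines kill three coordinates
  have hz0 : z = 0 := W1.resolve_left hd0
  have hx'0 : x' = 0 := W2.resolve_left hd0
  have hy''0 : y'' = 0 := W3.resolve_left hd0
  -- the three lines through `(1,1,1)` give three bilinear relations
  have R1 : x * b - y * a = 0 :=
    (mul_eq_zero.mp (by linear_combination W6 : d * (x * b - y * a) = 0)).resolve_left hd0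
  have R2 : y' * c - z' * b = 0 :=
    (mul_eq_zero.mp (by linear_combination W4 : d * (y' * c - z' * b) = 0)).resolve_left hd0
  have R3 : z'' * a - x'' * c = 0 :=
    (mul_eq_zero.mp (by linear_combination W5 : d * (z'' * a - x'' * c) = 0)).resolve_left hd0
  -- the seventh line: `b c · det = 2 a b y z' z''`
  have hT : 2 * a * b * y * z' * z'' = 0 := by
    linear_combination (b * c) * W7 - (a * y * z'') * R2 - (c * y' * z'') * R1 + (b * y * z') * R3 +
      (b * c * x * z') * hy''0 + (b * c * y * z'') * hx'0 + (b * c * y' * x'' - b * c * x' * y'') * hz0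
  exact (mul_ne_zero (mul_ne_zero (mul_ne_zero (mul_ne_zero (mul_ne_zero h2 ha) hb) hy) hz') hz'') hT

/-- Local-ring form of `fano_configuration_no_lift`: no lift of the Fano configuration modulo the maximal ideal of a
local domain `O` with `(2 : O) ≠ 0` (e.g. any mixed-characteristic `(0, 2)` discrete valuation ring). [folklore] -/
theorem fano_configuration_no_lift_local {O : Type*} [CommRing O] [IsDomain O] [IsLocalRing O]
    (h2 : (2 : O) ≠ 0) (v : (Fin 3 → ZMod 2) → Fin 3 → O)
    (hv : ∀ x i, v x i - ((x i).val : O) ∈ IsLocalRing.maximalIdeal O)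
    (hdet : ∀ a b : Fin 3 → ZMod 2, a ≠ 0 → b ≠ 0 → a ≠ b →
      (Matrix.of ![v a, v b, v (a + b)]).det = 0) :
    False :=
  fano_configuration_no_lift h2 _ (IsLocalRing.maximalIdeal.isMaximal O).ne_top v hv hdet

/-- Tightness: the hypothesis `(2 : O) ≠ 0` of `fano_configuration_no_lift` is load-bearing — if `2 = 0` in `O`
the constant `0/1` lift satisfies every hypothesis (for any ideal `I`). [folklore] -/
theorem fano_configuration_lift_of_two_eq_zero {O : Type*} [CommRing O] (h2 : (2 : O) = 0) (I : Ideal O) :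
    ∃ v : (Fin 3 → ZMod 2) → Fin 3 → O,
      (∀ x i, v x i - ((x i).val : O) ∈ I) ∧
      ∀ a b : Fin 3 → ZMod 2, a ≠ 0 → b ≠ 0 → a ≠ b →
        (Matrix.of ![v a, v b, v (a + b)]).det = 0 := by
  refine ⟨fun x i => ((x i).val : O), fun x i => by simp, ?_⟩
  intro a b _ _ _
  have hnat : ∀ s t : ZMod 2,
      (s + t).val = s.val + t.val ∨ ((s + t).val = 0 ∧ s.val = 1 ∧ t.val = 1) := by decide
  have hadd : ∀ s t : ZMod 2, (((s + t).val : ℕ) : O) = ((s.val : ℕ) : O) + ((t.val : ℕ) : O) := by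
    intro s t
    rcases hnat s t with h | ⟨h, hs, ht⟩
    · rw [h, Nat.cast_add]
    · rw [h, hs, ht, Nat.cast_zero, Nat.cast_one, one_add_one_eq_two, h2]
  have dep : ∀ r₁ r₂ : Fin 3 → O, (Matrix.of ![r₁, r₂, r₁ + r₂]).det = 0 := by
    intro r₁ r₂
    rw [Matrix.det_fin_three]
    simp only [Matrix.of_apply, Matrix.cons_val_zero, Matrix.cons_val_one, Matrix.cons_val,
      Pi.add_apply]
    ring
  have row : (fun i => ((((a + b) i).val : ℕ) : O)) =
      (fun i => (((a i).val : ℕ) : O)) + fun i => (((b i).val : ℕ) : O) := by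
    funext i
    rw [Pi.add_apply, Pi.add_apply]
    exact hadd (a i) (b i)
  show (Matrix.of ![fun i => (((a i).val : ℕ) : O), fun i => (((b i).val : ℕ) : O),
    fun i => ((((a + b) i).val : ℕ) : O)]).det = 0
  rw [row]
  exact dep _ _

end Summit.ResolutionOfSingularities.ResolutionOfSingularities.Theorems.EquisingularLift.Negative

end
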